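/-
Copyright: statement-level skeleton of a published paper (lit-balaban cell, Phase-2 proof seat p37 gen 109). No claims beyond
what the kernel checks below.
-/
import Mathlib
import Literature.MathematicalPhysics.QuantumFieldTheory.Balaban1983to89.B3OnePIChainClasses
import Literature.MathematicalPhysics.QuantumFieldTheory.Balaban1983to89.B3ChainRegroupingValues

/-!
# B3 — T. Bałaban, *(Higgs)₂,₃ quantum fields in a finite volume. III. Renormalization*, CMP **88** (1983) 411–445
[Balaban1983Higgs3], pp. 415–416 [PDF 5–6], (1.21): **THE TERMS OF (1.21) INDEXED BY ISOMORPHISM CLASSES OF GRAPHS — p32's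
isomorphism classes (`B3OnePIChainClasses`: `LetterClass`, `UnglueableClass`, `classEquiv`, `rep`, `repIso`) ARE a regrouping datum
(`B3ChainRegroupingValues.Regrouping`), hence the class values C₀·K(representative)·C₀ satisfy r15's resummed (1.21)**

statement-level skeleton of published theorems with citation tags; proofs where landed; nothing here is a claim about
the Yang–Mills mass gap

PDF held: `paper:balaban1983-higgs-2-3-quantum-fields-finite-volume` (journal page = PDF page + 410); p. 416 (1.21).

CITATION HEADER (lean-in-tree rule).  lit-balaban TYPED SKELETON (HOME `run/shared/lean/pub/lit-balaban/`), PHASE 2, seat p37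
gen 109 (unit `lit-balaban-p37`; TAKING (V), HOME/STATUS.md 2026-08-23T19:13Z; free-target protocol G.5-34(d)), row
**B3.Eq1.19-1.22** of `HOME/lit-balaban-r15/ROWS-B3.md` (fold owner r15, referee ref-4; OPTIONAL located member of the (1.21) cell,
zero head weight).  THE ITEM: p32 gen 44's `B3OnePIChainClasses` HONEST SCOPE (ii) (*"(1.21) for the series indexed by
`UnglueableClass` itself"*), delivered by instantiating p37's `B3ChainRegroupingValues` (the values side for an abstract regrouping
datum) at p32's classes.  CONSUMES BY NAME: p32's `B3OnePIChainClasses.{LetterClass, UnglueableClass, mkC, rep, repIso, glue,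
classEquiv, classEquiv_symm_apply, classEquivList}`, `B3OnePIChainUnglue.isoOfEq`; p37's `B3ChainRegroupingValues.{Regrouping,
LetterDressing, objValue, objOrder, objIndexEquiv, eq121_objValue, sigmaSeries_objValue_eq_greenSeries}`.  Nothing re-declared.

THE PRINTED TEXT (verbatim), p. 416 [PDF 6]: *"Σ^ε, Σ₁^ε, Σ₂^ε are given by amputated, one-particle-irreducible graphs of the
expansion of G^ε."*  p. 415 [PDF 5]: *"Now a graph for us is a collection of internal lines, external legs, and vertices connected
in the usual sense."*

KIND «(ours)» (G.5-54): plumbing; print provenance is claimed only for (1.21) and the p. 415 sentence.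
WHAT IS TYPED / PROVED (definitions with bodies + theorems; no `Prop` fact, no `sorry`; standard axioms).
`val_eq_mkC_chain` (an unglueable class IS the class of the chain of the representatives of its letter classes — p32's
`classEquiv.symm_apply_apply`), **`classRegrouping nbar : Regrouping nbar`** (letters := `LetterClass`, objects := `UnglueableClass`,
representatives := `rep`, `decomp := classEquiv`, `iso := isoOfEq ∘ repIso`), `objIndexEquiv_classRegrouping` (its index bijection
IS p32's `classEquivList`, `rfl`), **`eq121_classValue`** / **`sigmaSeries_classValue_eq_greenSeries`** (r15's `Eq121` for the series
indexed by the bare line ⊕ `UnglueableClass`, values through the chosen representatives, `X` = the letter classes' amputated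
kernels).
HONEST SCOPE: that of `B3ChainRegroupingValues` and of `B3OnePIChainClasses` (no `−δm²` letter, no sorting of the letters into
`Σ^ε, ∂^{ε*}Σ₁^ε, Σ₁^{ε*}∂^ε, ∂^{ε*}Σ₂^ε∂^ε`, no symmetry factors, nothing analytic).  Unit `lit-balaban-p37` gen 109
(literature-prover-lit-balaban-p37-g109-0), HOME `run/shared/lean/pub/lit-balaban/`, 2026-08-23.
-/

open Finset
open scoped BigOperators

namespace Literature.MathematicalPhysics.QuantumFieldTheory.Balaban1983to89.B3OnePIChainClassValues

open B3Prop1 B3Cor23Concrete B3GraphAmplitude B3GraphIso B3OnePIChainGlue B3OnePIChainAmplitude B3GraphIsoAmplitude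
  B3OnePIChainUnglue B3OnePIChainClasses B3ChainRegroupingValues

noncomputable section

variable {nbar : ℕ}

/-- kernel: **an unglueable class is the class of the chain of the representatives of its letter classes** (p32's `classEquiv`:
glue ∘ decompose = id, and `glue` is the class of that chain). [cite: Balaban1983Higgs3, (1.21) p.416] -/
theorem val_eq_mkC_chain (y : UnglueableClass nbar) :
    y.1 = mkC (chain (rep (classEquiv y).1.1) ((classEquiv y).2.map fun c => rep c.1)) := by
  show y.1 = (glue (classEquiv y)).1
  rw [← classEquiv_symm_apply, Equiv.symm_apply_apply]

variable (nbar) in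
/-- **p32's ISOMORPHISM CLASSES AS A REGROUPING DATUM**: letters = `LetterClass`, objects = `UnglueableClass`, representatives =
p32's chosen `rep`, the bijection = `classEquiv`, and the isomorphism of `rep y` onto the chain of the representatives of its letter
classes = `isoOfEq` (along `val_eq_mkC_chain`) followed by p32's `repIso`. [cite: Balaban1983Higgs3, (1.21) p.416]
[cite: Balaban1983Higgs3, p.415] -/
def classRegrouping : Regrouping nbar where
  Letter := LetterClass nbar
  Obj := UnglueableClass nbar
  repL c := rep c.1
  repO y := rep y.1
  decomp := classEquiv
  iso y := (isoOfEq (congrArg rep (val_eq_mkC_chain y))).trans (repIso _)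

/-- kernel: the index bijection of the class regrouping IS p32's `classEquivList`. [cite: Balaban1983Higgs3, (1.21) p.416] -/
theorem objIndexEquiv_classRegrouping : objIndexEquiv (classRegrouping nbar) = classEquivList := rfl

variable {SF VF OF IS IV IO : Type*} [Fintype IS] [Fintype IV] [Fintype IO] [DecidableEq IS]
  (bS : IS → SF) (bV : IV → VF) (bO : IO → OF) (C : IS → IS → ℝ)
  (Dc : LetterDressing (classRegrouping nbar) SF VF OF IS IV IO) {σ : Type*} (deg : LetterClass nbar → σ →₀ ℕ)

/-- **(1.21) INDEXED BY ISOMORPHISM CLASSES, I**: the generating series of the class values (bare line ⊕ `UnglueableClass`, each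
valued `C₀·K(rep y)·C₀` through its chosen representative with the transported chain dressing) IS p32's chain series of the letter
classes' amputated kernels. [cite: Balaban1983Higgs3, (1.21) p.416] -/
theorem sigmaSeries_classValue_eq_greenSeries :
    B3Eq121OnePIChains.sigmaSeries (objValue (classRegrouping nbar) bS bV bO C Dc) (objOrder (classRegrouping nbar) deg) =
      B3Eq121OnePIChains.greenSeries (Matrix.of C) (fun c => (Dc c).kernel bS bV bO) deg :=
  sigmaSeries_objValue_eq_greenSeries _ bS bV bO C Dc deg

/-- **(1.21) INDEXED BY ISOMORPHISM CLASSES, II**: if every letter class has positive order and each order carries finitely many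
letter classes, r15's resummed (1.21) `Eq121 G (C C₀) X` HOLDS for `G` = the series of the class values and `X` = the series of the
letter classes' amputated kernels — print's sum over graphs *"in the usual sense"*. [cite: Balaban1983Higgs3, (1.21) p.416]
[cite: Balaban1983Higgs3, p.415] -/
theorem eq121_classValue (hne : ∀ c, deg c ≠ 0) (hfin : ∀ d, {c | deg c = d}.Finite) :
    B3Sect1TwoPoint.Eq121
      (B3Eq121OnePIChains.sigmaSeries (objValue (classRegrouping nbar) bS bV bO C Dc) (objOrder (classRegrouping nbar) deg))
      (MvPowerSeries.C (Matrix.of C)) (B3Eq121OnePIChains.sigmaSeries (fun c => (Dc c).kernel bS bV bO) deg) :=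
  eq121_objValue _ bS bV bO C Dc deg hne hfin

end

end Literature.MathematicalPhysics.QuantumFieldTheory.Balaban1983to89.B3OnePIChainClassValues
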